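import Literature.Topology.FourManifolds.GradientLike
import Literature.Topology.FourManifolds.FlowsProofs
import Literature.Topology.FourManifolds.ChartDerivative
import Mathlib.Analysis.Calculus.BumpFunction.InnerProduct
import Mathlib.Analysis.Calculus.ContDiff.RCLike
import Mathlib.Analysis.ODE.ExistUnique
import Mathlib.Topology.Homotopy.Contractible
import HarnessLib

/-!
# Regular sublevel domains of a compact manifold: the collar flow, and the domain is homotopy
# equivalent to its interior and a deformation retract of a neighbourhood

Topic `Literature/Topology/FourManifolds` (the differential-topology shelf hosting the flow of a
vector field on a compact manifold, `Flows.lean`/`FlowsProofs.lean`, and Milnor's gradient-like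
fields, `GradientLike.lean`). For a smooth function `f` on a compact manifold `M` without
boundary such that `0` is a regular value along `{f = 0}`, the sublevel domain `D = {f ≤ 0}` is a
compact domain with smooth boundary `{f = 0}`; this file proves the two standard homotopical
facts about it that route and literature items phrased over sublevel domains need in order to
pass between `D`, its interior `{f < 0}` and its open neighbourhoods `{f < ε}` (all three carry
the problem "is `D` contractible?" equivalently):

* `{x // f x ≤ 0}` and `{x // f x < 0}` are homotopy equivalent
  (`nonempty_homotopyEquiv_sublevel_lt`), hence `ContractibleSpace` transfers both ways
  (`contractibleSpace_sublevel_iff_lt`);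
* for some `ε > 0` there is a retraction of `{x // f x < ε}` onto `{x // f x ≤ 0}`
  (`exists_retraction_sublevel`), so `D` is contractible as soon as some such neighbourhood is
  (`exists_pos_contractibleSpace_sublevel_of_lt`, through the general
  `contractibleSpace_of_retraction`).

Auxiliary, of independent use: `exists_pos_forall_abs_le_mfderiv_ne_zero` (a regular collar
`{|f| ≤ 3η}` on a compact manifold, from the tree's `isOpen_setOf_mfderiv_ne_zero` of
`ChartDerivative.lean`), `exists_contMDiffSection_mlineDeriv_eq` (a smooth vector field `V` with prescribed
`V(f) = c` when `tsupport c` consists of regular points — Milnor's partition-of-unity argument),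
`hasDerivAt_comp_of_mdifferentiableAt` (chain rule along a curve).

The tool is the **collar flow** (`exists_collarFlow`): a global flow `θ` of a smooth vector
field `V` with `df(V) = φ ∘ f` for a plateau function `φ` (`= 1` on `[-η, η]`, `≥ 0`, supported
in `(-2η, 2η)`, where `df ≠ 0` on `{|f| ≤ 3η}`), along which `f` is monotone and moves at unit
speed inside the collar `{|f| ≤ η}`: Milnor, *Morse theory* (1963), Thm. 3.1 ("if `f⁻¹[a, b]`
is compact and contains no critical points then `Mᵃ` is a deformation retract of `Mᵇ`", proof
by the flow of `ρ · grad f` with `ρ = 1/⟨grad f, grad f⟩` on `f⁻¹[a, b]`, compactly supported),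
here with the vector field produced by a partition of unity instead of a Riemannian gradient
(Milnor, *h-cobordism* (1965), Lemma 3.2, as in `GradientLike.lean`) and the flow supplied by
the tree's fundamental theorem on flows for compact manifolds
(`exists_contMDiff_globalFlow_holds`, Lee 2012, Thm. 9.12 / Cor. 9.17).

All results are proved; no definitions, no named facts.

## References

* J. Milnor, *Morse theory*, Annals of Mathematics Studies 51, Princeton (1963), §3, Thm. 3.1
  and its proof (pp. 12–13). [Milnor1963]
* J. Milnor, *Lectures on the h-cobordism theorem* (1965), Lemma 3.2 (gradient-like fields by a
  partition of unity). [MilnorHCobordism1965]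
* J. M. Lee, *Introduction to Smooth Manifolds*, 2nd ed. (2012), Thm. 9.12, Cor. 9.17.
  [LeeSmoothManifolds2013]
-/

open scoped Manifold ContDiff Topology
open Set Function Filter Metric Bundle

noncomputable section

namespace Literature.Topology.FourManifolds

universe u v w

section VectorField

variable {E : Type*} [NormedAddCommGroup E] [NormedSpace ℝ E]
  {H : Type*} [TopologicalSpace H] {I : ModelWithCorners ℝ E H}
  {M : Type*} [TopologicalSpace M] [ChartedSpace H M] [IsManifold I ∞ M]

/-- **A regular collar.** On a compact manifold, if `0` is a regular value of the smooth
function `f` along `{f = 0}` (`df_x ≠ 0` whenever `f x = 0`), then `df ≠ 0` on a whole band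
`{|f| ≤ 3η}`, `η > 0` (the critical set is compact and `|f|` is positive on it).
Milnor 1963, §3, setting of Thm. 3.1. [cite: Milnor1963, Thm. 3.1] -/
theorem exists_pos_forall_abs_le_mfderiv_ne_zero [CompactSpace M] {f : M → ℝ}
    (hf : ContMDiff I 𝓘(ℝ, ℝ) ∞ f) (hreg : ∀ x, f x = 0 → mfderiv I 𝓘(ℝ, ℝ) f x ≠ 0) :
    ∃ η > (0 : ℝ), ∀ x, |f x| ≤ 3 * η → mfderiv I 𝓘(ℝ, ℝ) f x ≠ 0 := by
  set K : Set M := {x : M | mfderiv I 𝓘(ℝ, ℝ) f x ≠ 0}ᶜ with hK_def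
  have hKc : IsCompact K := (isOpen_setOf_mfderiv_ne_zero hf).isClosed_compl.isCompact
  rcases K.eq_empty_or_nonempty with hKe | hKne
  · refine ⟨1, one_pos, fun x _ ↦ ?_⟩
    have hx : x ∉ K := by rw [hKe]; exact notMem_empty x
    simpa [hK_def] using hx
  · have hcont : ContinuousOn (fun x ↦ |f x|) K := (continuous_abs.comp hf.continuous).continuousOn
    obtain ⟨x₁, hx₁K, hx₁⟩ := hKc.exists_isMinOn hKne hcont
    have hpos : 0 < |f x₁| := by
      rw [abs_pos]
      intro h0
      exact hx₁K (hreg x₁ h0)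
    refine ⟨|f x₁| / 4, by positivity, fun x hx ↦ ?_⟩
    by_contra h
    have hxK : x ∈ K := by simpa [hK_def] using h
    have hmin : |f x₁| ≤ |f x| := hx₁ hxK
    linarith

variable [FiniteDimensional ℝ E] [T2Space M] [SigmaCompactSpace M]

/-- **A smooth vector field with prescribed derivative `V(f) = c`** (Milnor 1965, Lemma 3.2,
partition-of-unity construction; Milnor 1963, proof of Thm. 3.1, where `V = ρ · grad f`). On a
`σ`-compact Hausdorff manifold, for a smooth `f` and a smooth function `c` whose topological
support consists of regular points of `f`, there is a smooth vector field `V` with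
`df_x(V_x) = c x` for all `x`: the fibrewise condition is affine (convex), locally solvable by
`(c / s(f)) • s` for a local field `s` with `s(f) ≠ 0` near points of the support and by `0` off
the support, and Mathlib's `exists_contMDiffSection_forall_mem_convex_of_local` glues.
[cite: MilnorHCobordism1965, Lemma 3.2] -/
theorem exists_contMDiffSection_mlineDeriv_eq {f : M → ℝ} (hf : ContMDiff I 𝓘(ℝ, ℝ) ∞ f)
    {c : M → ℝ} (hc : ContMDiff I 𝓘(ℝ, ℝ) ∞ c)
    (hsupp : tsupport c ⊆ {x : M | mfderiv I 𝓘(ℝ, ℝ) f x ≠ 0}) :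
    ∃ V : Cₛ^∞⟮I; E, (TangentSpace I : M → Type _)⟯, ∀ x, mlineDeriv I f x (V x) = c x := by
  refine exists_contMDiffSection_forall_mem_convex_of_local I (TangentSpace I : M → Type _)
    (fun x => {v : TangentSpace I x | mlineDeriv I f x v = c x}) (fun x ↦ ?_) (fun x₀ ↦ ?_)
  · -- the fibrewise condition is affine, hence convex
    intro v hv w hw a b _ _ hab
    simp only [mem_setOf_eq, mlineDeriv_add, mlineDeriv_smul] at hv hw ⊢
    rw [hv, hw, ← add_mul, hab, one_mul]
  · by_cases hx₀ : x₀ ∈ tsupport c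
    · -- near a point of the support: `(c / s(f)) • s`
      obtain ⟨v₀, hv₀⟩ := exists_mlineDeriv_ne_zero (I := I) (hsupp hx₀)
      obtain ⟨u, s, hu, hx₀u, hsx₀, hs⟩ := exists_contMDiffOn_section_eq (I := I) x₀ v₀
      set g : M → ℝ := fun x ↦ mlineDeriv I f x (s x) with hg_def
      have hg : ContMDiffOn I 𝓘(ℝ, ℝ) ∞ g u := contMDiffOn_mlineDeriv_section hf hs
      have hgx₀ : g x₀ ≠ 0 := by
        simp only [hg_def, hsx₀]
        exact hv₀
      set u' : Set M := u ∩ {x | g x ≠ 0} with hu'_def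
      have hu'o : IsOpen u' := hg.continuousOn.isOpen_inter_preimage hu isOpen_ne
      have hx₀u' : x₀ ∈ u' := ⟨hx₀u, hgx₀⟩
      refine ⟨u', hu'o.mem_nhds hx₀u', fun x ↦ (c x / g x) • s x, ?_, fun y hy ↦ ?_⟩
      · have h1 : ContMDiffOn I 𝓘(ℝ, ℝ) ∞ (fun x ↦ c x / g x) u' :=
          (hc.contMDiffOn.mono inter_subset_left).div₀ (hg.mono inter_subset_left)
            fun x hx ↦ hx.2
        exact h1.smul_section (hs.mono inter_subset_left)
      · simp only [mem_setOf_eq, mlineDeriv_smul]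
        exact div_mul_cancel₀ (c y) hy.2
    · -- off the support: the zero field
      have hzero : ∀ᶠ y in 𝓝 x₀, c y = 0 := by
        have h : (tsupport c)ᶜ ∈ 𝓝 x₀ := (isClosed_tsupport c).isOpen_compl.mem_nhds hx₀
        filter_upwards [h] with y hy using image_eq_zero_of_notMem_tsupport hy
      obtain ⟨U, hU, hUo, hx₀U⟩ := eventually_nhds_iff.1 hzero
      refine ⟨U, hUo.mem_nhds hx₀U, fun _ ↦ 0, ?_, fun y hy ↦ ?_⟩
      · exact (contMDiff_zeroSection ℝ (TangentSpace I : M → Type _)).contMDiffOn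
      · simp only [mem_setOf_eq, hU y hy]
        exact (mfderiv I 𝓘(ℝ, ℝ) f y).map_zero

end VectorField


/-! ### The collar flow -/

section CollarFlow

variable {E : Type u} [NormedAddCommGroup E] [NormedSpace ℝ E] [FiniteDimensional ℝ E]
  {H : Type v} [TopologicalSpace H] {I : ModelWithCorners ℝ E H} [I.Boundaryless]
  {M : Type w} [TopologicalSpace M] [ChartedSpace H M] [IsManifold I ∞ M]
  [T2Space M] [SecondCountableTopology M] [CompactSpace M]

omit [FiniteDimensional ℝ E] [I.Boundaryless] [IsManifold I ∞ M] [T2Space M]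
  [SecondCountableTopology M] [CompactSpace M] in
/-- Chain rule along a curve: `(f ∘ γ)'(t) = df_{γ t}(γ' t)` with `γ' t = dγ_t(1)`, for `f`
differentiable at `γ t` and `γ` differentiable at `t` (the `HasDerivAt` form). [folklore] -/
theorem hasDerivAt_comp_of_mdifferentiableAt {γ : ℝ → M} {t : ℝ} {f : M → ℝ}
    (hf : MDifferentiableAt I 𝓘(ℝ, ℝ) f (γ t)) (hγ : MDifferentiableAt 𝓘(ℝ, ℝ) I γ t) :
    HasDerivAt (fun t' ↦ f (γ t'))
      (mfderiv I 𝓘(ℝ, ℝ) f (γ t) (mfderiv 𝓘(ℝ, ℝ) I γ t (1 : ℝ))) t := by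
  have h₂ := hf.hasMFDerivAt.comp t hγ.hasMFDerivAt
  rw [hasMFDerivAt_iff_hasFDerivAt] at h₂
  set L : ℝ →L[ℝ] ℝ :=
    (mfderiv I 𝓘(ℝ, ℝ) f (γ t)).comp (mfderiv 𝓘(ℝ, ℝ) I γ t) with hL
  have h₃ : HasFDerivAt (f ∘ γ) L t := h₂
  exact h₃.hasDerivAt

/-- **The collar flow of a regular sublevel domain** (Milnor 1963, Thm. 3.1, proof: the flow of
the compactly supported field `ρ · grad f`, `ρ = 1/|grad f|²` on `f⁻¹[a, b]`, pushes levels to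
levels at unit speed). Let `M` be a compact manifold without boundary and `f : M → ℝ` smooth
with `df ≠ 0` along `{f = 0}`. Then there are `η > 0` and a continuous global flow
`θ : ℝ × M → M` (`θ(0, x) = x`, `θ(t, θ(s, x)) = θ(t + s, x)`) along which `f` is monotone
(non-decreasing in `t`) and which has unit speed in the collar:
`f (θ (t, x)) = f x + t` whenever `f x` and `f x + t` both lie in `[-η, η]`. Construction: a
plateau function `φ` (`= 1` on `[-η, η]`, supported in `(-2η, 2η)`, with `df ≠ 0` on
`{|f| ≤ 3η}` by `exists_pos_forall_abs_le_mfderiv_ne_zero`), a smooth field `V` with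
`V(f) = φ ∘ f` (`exists_contMDiffSection_mlineDeriv_eq`), its global flow
(`exists_contMDiff_globalFlow_holds`, Lee 2012, Thm. 9.12/Cor. 9.17); along a flow line
`u = f ∘ θ(·, x)` solves `u' = φ(u) ≥ 0`, and in the collar it is compared with `s ↦ f x + s`
by uniqueness for Lipschitz ODEs. [cite: Milnor1963, Thm. 3.1] -/
theorem exists_collarFlow {f : M → ℝ} (hf : ContMDiff I 𝓘(ℝ, ℝ) ∞ f)
    (hreg : ∀ x, f x = 0 → mfderiv I 𝓘(ℝ, ℝ) f x ≠ 0) :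
    ∃ η > (0 : ℝ), ∃ θ : ℝ × M → M, Continuous θ ∧ (∀ x, θ (0, x) = x) ∧
      (∀ t s x, θ (t, θ (s, x)) = θ (t + s, x)) ∧
      (∀ x, Monotone fun t ↦ f (θ (t, x))) ∧
      ∀ x t, f x ∈ Icc (-η) η → f x + t ∈ Icc (-η) η → f (θ (t, x)) = f x + t := by
  obtain ⟨η, hη, hband⟩ := exists_pos_forall_abs_le_mfderiv_ne_zero hf hreg
  -- the plateau function
  let φ : ContDiffBump (0 : ℝ) := ⟨η, 2 * η, hη, by linarith⟩
  have hφ1 : ∀ y ∈ Icc (-η) η, φ y = 1 := by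
    intro y hy
    apply φ.one_of_mem_closedBall
    rw [mem_closedBall, Real.dist_eq, sub_zero]
    exact abs_le.2 ⟨hy.1, hy.2⟩
  -- the right-hand side `c = φ ∘ f` and its support
  set c : M → ℝ := fun x ↦ φ (f x) with hc_def
  have hc : ContMDiff I 𝓘(ℝ, ℝ) ∞ c := φ.contDiff.comp_contMDiff hf
  have hsupp : tsupport c ⊆ {x : M | mfderiv I 𝓘(ℝ, ℝ) f x ≠ 0} := by
    intro x hx
    apply hband x
    have hsub : Function.support c ⊆ f ⁻¹' ball (0 : ℝ) (2 * η) := by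
      intro y hy
      have h : f y ∈ Function.support (φ : ℝ → ℝ) := hy
      rwa [φ.support_eq] at h
    have h1 : tsupport c ⊆ f ⁻¹' closedBall (0 : ℝ) (2 * η) :=
      calc tsupport c = closure (Function.support c) := rfl
        _ ⊆ closure (f ⁻¹' ball (0 : ℝ) (2 * η)) := closure_mono hsub
        _ ⊆ f ⁻¹' closure (ball (0 : ℝ) (2 * η)) := hf.continuous.closure_preimage_subset _
        _ ⊆ f ⁻¹' closedBall (0 : ℝ) (2 * η) := preimage_mono closure_ball_subset_closedBall
    have h2 := h1 hx
    rw [mem_preimage, mem_closedBall, Real.dist_eq, sub_zero] at h2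
    linarith
  -- the vector field and its flow
  obtain ⟨V, hV⟩ := exists_contMDiffSection_mlineDeriv_eq hf hc hsupp
  obtain ⟨θ, hθs, hθ0, hθgrp, hθint⟩ :=
    exists_contMDiff_globalFlow_holds I M (fun x ↦ V x) V.contMDiff
  -- `f` along flow lines solves `u' = φ(u)`
  have hderiv : ∀ x t, HasDerivAt (fun t ↦ f (θ (t, x))) (φ (f (θ (t, x)))) t := by
    intro x t
    have hγ : MDifferentiableAt 𝓘(ℝ, ℝ) I (fun t ↦ θ (t, x)) t := (hθint x t).mdifferentiableAt
    have hD := hasDerivAt_comp_of_mdifferentiableAt (hf.mdifferentiableAt (by simp)) hγ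
    have hvel : mfderiv 𝓘(ℝ, ℝ) I (fun t ↦ θ (t, x)) t (1 : ℝ) = (1 : ℝ) • V (θ (t, x)) := by
      rw [(hθint x t).mfderiv]
      rfl
    have hval : mlineDeriv I f (θ (t, x)) (mfderiv 𝓘(ℝ, ℝ) I (fun t ↦ θ (t, x)) t (1 : ℝ)) =
        φ (f (θ (t, x))) := by
      rw [hvel, mlineDeriv_smul, one_mul]
      exact hV _
    exact hD.congr_deriv hval
  obtain ⟨K, hK⟩ := ContDiff.lipschitzWith_of_hasCompactSupport φ.hasCompactSupport
    (φ.contDiff (n := 1)) one_ne_zero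
  refine ⟨η, hη, θ, hθs.continuous, hθ0, hθgrp, fun x ↦ ?_, fun x t hx hxt ↦ ?_⟩
  · -- monotone
    exact monotone_of_deriv_nonneg (fun t ↦ (hderiv x t).differentiableAt) fun t ↦ by
      rw [(hderiv x t).deriv]
      exact φ.nonneg
  · -- unit speed in the collar: compare with `s ↦ f x + s`
    have hcont : Continuous fun t ↦ f (θ (t, x)) :=
      continuous_iff_continuousAt.2 fun t ↦ (hderiv x t).continuousAt
    have hg : ∀ s, HasDerivAt (fun s ↦ f x + s) 1 s := fun s ↦ (hasDerivAt_id s).const_add (f x)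
    have h0 : f (θ (0, x)) = f x + 0 := by rw [hθ0, add_zero]
    rcases le_or_gt 0 t with ht | ht
    · have hbetween : ∀ s ∈ Ico 0 t, f x + s ∈ Icc (-η) η := fun s hs ↦
        ⟨by linarith [hx.1, hs.1], by linarith [hxt.2, hs.2]⟩
      have heq := ODE_solution_unique_of_mem_Icc_right (v := fun _ y ↦ φ y) (s := fun _ ↦ univ)
        (K := K) (f := fun t ↦ f (θ (t, x))) (g := fun s ↦ f x + s) (a := 0) (b := t)
        (fun _ _ ↦ hK.lipschitzOnWith) hcont.continuousOn
        (fun s _ ↦ (hderiv x s).hasDerivWithinAt) (fun _ _ ↦ mem_univ _)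
        (continuous_const.add continuous_id).continuousOn
        (fun s hs ↦ by
          have h := (hg s).hasDerivWithinAt (s := Ici s)
          rwa [← hφ1 _ (hbetween s hs)] at h)
        (fun _ _ ↦ mem_univ _) h0
      exact heq ⟨ht, le_rfl⟩
    · have hbetween : ∀ s ∈ Ioc t 0, f x + s ∈ Icc (-η) η := fun s hs ↦
        ⟨by linarith [hxt.1, hs.1], by linarith [hx.2, hs.2]⟩
      have heq := ODE_solution_unique_of_mem_Icc_left (v := fun _ y ↦ φ y) (s := fun _ ↦ univ)
        (K := K) (f := fun t ↦ f (θ (t, x))) (g := fun s ↦ f x + s) (a := t) (b := 0)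
        (fun _ _ ↦ hK.lipschitzOnWith) hcont.continuousOn
        (fun s _ ↦ (hderiv x s).hasDerivWithinAt) (fun _ _ ↦ mem_univ _)
        (continuous_const.add continuous_id).continuousOn
        (fun s hs ↦ by
          have h := (hg s).hasDerivWithinAt (s := Iic s)
          rwa [← hφ1 _ (hbetween s hs)] at h)
        (fun _ _ ↦ mem_univ _) h0
      exact heq ⟨le_rfl, ht.le⟩

end CollarFlow


/-! ### Homotopical consequences for the sublevel domain `{f ≤ 0}` -/

section Homotopy

/-- **A retract of a contractible space is contractible**: if `r ∘ i = id_X` for continuous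
`i : X → Y`, `r : Y → X` and `Y` is contractible, so is `X` (`id_X = r ∘ id_Y ∘ i ≃ r ∘ const ∘ i`).
[folklore] -/
theorem contractibleSpace_of_retraction {X Y : Type*} [TopologicalSpace X] [TopologicalSpace Y]
    [ContractibleSpace Y] (i : C(X, Y)) (r : C(Y, X)) (h : ∀ x, r (i x) = x) :
    ContractibleSpace X := by
  obtain ⟨y₀, hy₀⟩ := (contractible_iff_id_nullhomotopic Y).1 inferInstance
  rw [contractible_iff_id_nullhomotopic]
  refine ⟨r y₀, ?_⟩
  have h1 : (r.comp ((ContinuousMap.id Y).comp i)).Homotopic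
      (r.comp ((ContinuousMap.const Y y₀).comp i)) :=
    ContinuousMap.Homotopic.comp (ContinuousMap.Homotopic.refl r)
      (ContinuousMap.Homotopic.comp hy₀ (ContinuousMap.Homotopic.refl i))
  have h2 : r.comp ((ContinuousMap.id Y).comp i) = ContinuousMap.id X := by
    ext x
    exact h x
  have h3 : r.comp ((ContinuousMap.const Y y₀).comp i) = ContinuousMap.const X (r y₀) := by
    ext x
    rfl
  rwa [h2, h3] at h1

variable {E : Type u} [NormedAddCommGroup E] [NormedSpace ℝ E] [FiniteDimensional ℝ E]
  {H : Type v} [TopologicalSpace H] {I : ModelWithCorners ℝ E H} [I.Boundaryless]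
  {M : Type w} [TopologicalSpace M] [ChartedSpace H M] [IsManifold I ∞ M]
  [T2Space M] [SecondCountableTopology M] [CompactSpace M]

/-- **A regular sublevel domain is homotopy equivalent to its interior** (Milnor 1963, Thm. 3.1
and its proof: pushing in along the collar flow). On a compact manifold without boundary, for a
smooth `f` with `df ≠ 0` along `{f = 0}`, the inclusion `{f < 0} ↪ {f ≤ 0}` is a homotopy
equivalence, with homotopy inverse `x ↦ θ(-η/2, x)` for the collar flow `θ`
(`exists_collarFlow`): `f` does not increase backwards along `θ`, and decreases by exactly `η/2`
from the boundary. [cite: Milnor1963, Thm. 3.1] -/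
theorem nonempty_homotopyEquiv_sublevel_lt {f : M → ℝ} (hf : ContMDiff I 𝓘(ℝ, ℝ) ∞ f)
    (hreg : ∀ x, f x = 0 → mfderiv I 𝓘(ℝ, ℝ) f x ≠ 0) :
    Nonempty (ContinuousMap.HomotopyEquiv {x : M // f x ≤ 0} {x : M // f x < 0}) := by
  obtain ⟨η, hη, θ, hθc, hθ0, -, hmono, hcollar⟩ := exists_collarFlow hf hreg
  -- pushing in does not increase `f`, and strictly decreases it from the boundary
  have hle : ∀ (x : M) (s : ℝ), 0 ≤ s → f (θ (-s, x)) ≤ f x := fun x s hs ↦ by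
    have h := hmono x (neg_nonpos.2 hs)
    simpa only [hθ0] using h
  have hlt : ∀ x : M, f x ≤ 0 → f (θ (-(η / 2), x)) < 0 := by
    intro x hx
    rcases hx.lt_or_eq with h | h
    · exact lt_of_le_of_lt (hle x (η / 2) (by positivity)) h
    · have h1 : f x ∈ Icc (-η) η := by rw [h]; constructor <;> linarith
      have h2 : f x + -(η / 2) ∈ Icc (-η) η := by rw [h]; constructor <;> linarith
      rw [hcollar x (-(η / 2)) h1 h2, h]
      linarith
  -- continuity of the push maps `(s, x) ↦ θ (-(η/2) (1 - s), x)` on `I × _`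
  have hpush : ∀ {p : M → Prop}, Continuous fun q : unitInterval × {x : M // p x} ↦
      θ (-(η / 2) * (1 - (q.1 : ℝ)), (q.2 : M)) := by
    intro p
    refine hθc.comp (Continuous.prodMk ?_ (continuous_subtype_val.comp continuous_snd))
    exact continuous_const.mul
      (continuous_const.sub (continuous_subtype_val.comp continuous_fst))
  have hcoef : ∀ s : unitInterval, 0 ≤ (η / 2) * (1 - (s : ℝ)) := fun s ↦
    mul_nonneg (by positivity) (sub_nonneg.2 s.2.2)
  -- the two maps
  let j : C({x : M // f x ≤ 0}, {x : M // f x < 0}) :=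
    ⟨fun x ↦ ⟨θ (-(η / 2), x), hlt x x.2⟩,
      (hθc.comp (continuous_const.prodMk continuous_subtype_val)).subtype_mk _⟩
  let i : C({x : M // f x < 0}, {x : M // f x ≤ 0}) :=
    ⟨fun x ↦ ⟨x, x.2.le⟩, continuous_subtype_val.subtype_mk _⟩
  have hmem₁ : ∀ q : unitInterval × {x : M // f x ≤ 0},
      f (θ (-(η / 2) * (1 - (q.1 : ℝ)), (q.2 : M))) ≤ 0 := fun q ↦ by
    have h := hle (q.2 : M) ((η / 2) * (1 - (q.1 : ℝ))) (hcoef q.1)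
    rw [neg_mul]
    exact h.trans q.2.2
  have hmem₂ : ∀ q : unitInterval × {x : M // f x < 0},
      f (θ (-(η / 2) * (1 - (q.1 : ℝ)), (q.2 : M))) < 0 := fun q ↦ by
    have h := hle (q.2 : M) ((η / 2) * (1 - (q.1 : ℝ))) (hcoef q.1)
    rw [neg_mul]
    exact lt_of_le_of_lt h q.2.2
  let F₁ : (i.comp j).Homotopy (ContinuousMap.id {x : M // f x ≤ 0}) :=
    { toFun := fun q ↦ ⟨θ (-(η / 2) * (1 - (q.1 : ℝ)), (q.2 : M)), hmem₁ q⟩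
      continuous_toFun := hpush.subtype_mk _
      map_zero_left := fun x ↦ by
        apply Subtype.ext
        simp [i, j]
      map_one_left := fun x ↦ by
        apply Subtype.ext
        simp [hθ0] }
  let F₂ : (j.comp i).Homotopy (ContinuousMap.id {x : M // f x < 0}) :=
    { toFun := fun q ↦ ⟨θ (-(η / 2) * (1 - (q.1 : ℝ)), (q.2 : M)), hmem₂ q⟩
      continuous_toFun := hpush.subtype_mk _
      map_zero_left := fun x ↦ by
        apply Subtype.ext
        simp [i, j]
      map_one_left := fun x ↦ by
        apply Subtype.ext
        simp [hθ0] }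
  exact ⟨⟨j, i, ⟨F₁⟩, ⟨F₂⟩⟩⟩

/-- **`{f ≤ 0}` is contractible iff `{f < 0}` is** (regular sublevel domain of a compact
manifold without boundary; consequence of `nonempty_homotopyEquiv_sublevel_lt`).
[cite: Milnor1963, Thm. 3.1] -/
theorem contractibleSpace_sublevel_iff_lt {f : M → ℝ} (hf : ContMDiff I 𝓘(ℝ, ℝ) ∞ f)
    (hreg : ∀ x, f x = 0 → mfderiv I 𝓘(ℝ, ℝ) f x ≠ 0) :
    ContractibleSpace {x : M // f x ≤ 0} ↔ ContractibleSpace {x : M // f x < 0} := by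
  obtain ⟨e⟩ := nonempty_homotopyEquiv_sublevel_lt hf hreg
  exact e.contractibleSpace_iff

/-- **`{f ≤ 0}` is a retract of the open neighbourhood `{f < η}`** (Milnor 1963, Thm. 3.1:
`Mᵃ` is a deformation retract of `Mᵇ` when `f⁻¹[a, b]` is compact without critical points; here
the retraction `x ↦ θ(-max(f x, 0), x)` along the collar flow, which lowers `f` from `f x` to
exactly `0` on `{0 < f < η}` and fixes `{f ≤ 0}`). [cite: Milnor1963, Thm. 3.1] -/
theorem exists_retraction_sublevel {f : M → ℝ} (hf : ContMDiff I 𝓘(ℝ, ℝ) ∞ f)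
    (hreg : ∀ x, f x = 0 → mfderiv I 𝓘(ℝ, ℝ) f x ≠ 0) :
    ∃ ε > (0 : ℝ), ∃ r : C({x : M // f x < ε}, {x : M // f x ≤ 0}),
      ∀ x : {x : M // f x < ε}, f x ≤ 0 → (r x : M) = x := by
  obtain ⟨η, hη, θ, hθc, hθ0, -, -, hcollar⟩ := exists_collarFlow hf hreg
  have hmem : ∀ x : M, f x < η → f (θ (-max (f x) 0, x)) ≤ 0 := by
    intro x hx
    rcases le_or_gt (f x) 0 with h | h
    · rw [max_eq_right h, neg_zero, hθ0]
      exact h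
    · rw [max_eq_left h.le]
      have h1 : f x ∈ Icc (-η) η := ⟨by linarith, hx.le⟩
      have h2 : f x + -f x ∈ Icc (-η) η := by rw [add_neg_cancel]; constructor <;> linarith
      rw [hcollar x (-f x) h1 h2, add_neg_cancel]
  refine ⟨η, hη, ⟨fun x ↦ ⟨θ (-max (f x) 0, x), hmem x x.2⟩, ?_⟩, fun x hx ↦ ?_⟩
  · refine (hθc.comp (Continuous.prodMk ?_ continuous_subtype_val)).subtype_mk _
    exact ((hf.continuous.comp continuous_subtype_val).max continuous_const).neg
  · show θ (-max (f x) 0, (x : M)) = x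
    rw [max_eq_right hx, neg_zero, hθ0]

/-- **If some neighbourhood `{f < ε}`, `0 < ε` small, is contractible then so is `{f ≤ 0}`**
(a retract of a contractible space is contractible; `exists_retraction_sublevel`). Precisely:
there is `ε₀ > 0` such that for every `ε ∈ (0, ε₀]`, contractibility of `{f < ε}` implies that of
`{f ≤ 0}`. [cite: Milnor1963, Thm. 3.1] -/
theorem exists_pos_contractibleSpace_sublevel_of_lt {f : M → ℝ} (hf : ContMDiff I 𝓘(ℝ, ℝ) ∞ f)
    (hreg : ∀ x, f x = 0 → mfderiv I 𝓘(ℝ, ℝ) f x ≠ 0) :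
    ∃ ε₀ > (0 : ℝ), ∀ ε, 0 < ε → ε ≤ ε₀ →
      ContractibleSpace {x : M // f x < ε} → ContractibleSpace {x : M // f x ≤ 0} := by
  obtain ⟨ε₀, hε₀, r, hr⟩ := exists_retraction_sublevel hf hreg
  refine ⟨ε₀, hε₀, fun ε hε hεle hcontr ↦ ?_⟩
  -- restrict the retraction to `{f < ε} ⊆ {f < ε₀}`
  let incl : C({x : M // f x < ε}, {x : M // f x < ε₀}) :=
    ⟨fun x ↦ ⟨x, lt_of_lt_of_le x.2 hεle⟩, continuous_subtype_val.subtype_mk _⟩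
  let i : C({x : M // f x ≤ 0}, {x : M // f x < ε}) :=
    ⟨fun x ↦ ⟨x, lt_of_le_of_lt x.2 hε⟩, continuous_subtype_val.subtype_mk _⟩
  exact contractibleSpace_of_retraction i (r.comp incl) fun x ↦ Subtype.ext (hr (incl (i x)) x.2)

end Homotopy

end Literature.Topology.FourManifolds

end
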